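import Summits.QuantumFields.YangMills.Theorems.BalabanUVNodesK0AxJoinTKStep

/-!
# K0ᴬ JOIN-T, GEOMETRY HAND α — the record rows (G0) + (G3) + (G4) of `kstep_joinT_at_record` AT ◆ CRIT-1's RECORD CHOICES, PROVED

Cell `ym-nodeO-ideate`, helper-hand seat `ymgap-nodeO-hand-geomA` (gen 0; ladder-directors R657-ym, director-ym №533 (3), ◆ CRIT-1 g36 cut of JOIN-T v2
`nodeO-cover/LENS-1g9-JoinT-v2.lean` b7b49705adbb81b3, nodeO STATUS l.4915 (A)(D)); `--supports stmt-QuantumFields-27238 --as helper`; count-neutral.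
[I] = [Balaban1987RG1].

WHAT THIS FILE IS.  ◇ lens-1 g9's `kstep_joinT_at_record` (JOIN-T v2 §K, binder :671; its generic halves are the tree's ✓`…K0AxJoinTLeaves` ∕ ✓`…K0AxJoinT`)
takes, next to the content rows D1 ∕ D9 ∕ D13, five GEOMETRY rows (G0)–(G4) at the record names and an inner window ∕ seam separation ∕ rate triple
`(Nin, Rsep, cR)`.  ◆ CRIT-1 g36 graded (G0), (G3), (G4) «RECORD FACT, dischargeable now» at the choices
`Nin k n := recordRNat F Mc k (recordK₀ F Mc k + n)`, `Rsep k n := recordR F Mc k (recordK₀ F Mc k + n) ∕ 2 − 2·Mc`, `cR := 1∕16` (with the safety split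
«`Nin := 0`, `Rsep := recordN` on members with fewer than 16 cubes per direction»).  This file PROVES those three rows, each stated as the corresponding
binder of :671 instantiated at the choices:

* §1 **(G0), EVERY volume, NO guard**: `q_K ≤ q_{K+1}` (`domCount_le_domCount_succ`), so the centred cube lift `liftCubeCtr` (least-absolute-value residues
  `ZMod q_K → ℤ → ZMod q_{K+1}`) is INJECTIVE (`liftCubeCtr_injective`); off the wrap class `recordDomEmbCtr X` IS the lifted cube family
  (✓`recordDomEmbCtr_val_of_not_mem`), hence ★ `recordDomEmbCtr_injOn` and the row ★ `rowG0` — binder :691 verbatim.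
* §2 the member range in closed form (under the catalogue guard `McGuard F Mc`, i.e. `Mc = L^c`, which the JOIN's antecedents carry): member `n` = volume
  `recordK₀ F Mc k + n` has `q = 2·L^{m+n}` cubes per direction (`domCount_member_eq`), radius `recordRNat = Mc·L^{m+n}` (`recordRNat_member_eq`,
  `recordR_member_eq`), window `recordN = 2·Mc·L^{m+n}` (`recordN_member_eq`); in particular `16 ≤ q` at EVERY member (`sixteen_le_domCount_member`, from
  `L > 11`, `m ≥ 1`) — ◆'s safety split never fires, so the rows are proved both at the plain choices and at the literal `if 16 ≤ q then … else …` choices.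
* §3 **(G3)**: `Nin ≤ recordRNat` (★ `rowG3a`, `rowG3a_if`) and eventual membership of every label in the inner window (★ `rowG3b`, `rowG3b_if`; the tree's
  ✓`PortHRecordRowG.eventually_window`) — binder :702 verbatim.
* §4 **(G4)**: `cR·recordN ≤ Rsep ∧ recordN∕4 ≤ recordRNat` at `cR = 1∕16` (★ `rowG4`, `rowG4_if`; `0 < cR ≤ 1∕4` is `cR_record`) — binder :703–704 verbatim.
* §5 ★★ `geomRowsA_at_record_choices`: the four binders :691 ∕ :702 ∕ :703–704 TOGETHER, written with `Nin ∕ Rsep ∕ cR` `let`-bound to the choices (so the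
  consumer's `kstep_joinT_at_record … Nin Rsep cR hcR hcR4 … hinj … hNin hwin hNR …` slots are filled by `.1 ∕ .2.…` of one term), and `geomRowsA_at_record_choices_if`
  for the literal guarded choices.
* §6 ★★★ `kstep_joinT_at_record_geomA` — THE FIT, KERNEL-CHECKED: the tree's ✓`K0AxJoinT.kstep_joinT_at_record` (✓`…K0AxJoinTKStep`) with `Nin ∕ Rsep ∕ cR` FIXED to the
  choices and the rows `0 < cR ≤ 1∕4`, (G0), (G3a), (G3b), (G4) DISCHARGED by §1–§4 (one `exact`); what remains displayed is D1, the swap row, D9 + D13, (G1)(G2) at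
  `(Nin, Rsep) = (recordRNat, recordR∕2 − 2·Mc)` (hand β's rows, verbatim at the choices) and the leaves; conclusion [E] at rate `delta1 δ₀ κ Mg ∕ 16`.

NOT HERE (other owners, ◆'s grading): (G1)(G2) LARGE-OR-FAR (hand β; they need `Mg ≥ 4·Mc`, which no row of this file reads); H2 swap row and D13 (hand γ ∕ P0
lane); D1 ∕ D9 content.

HONEST FRAMING.  Elementary torus ∕ integer bookkeeping about the record NAMES (helper rows of the NODE O record-format programme — registry bookkeeping for
director-ym, NOT a proof of anything of Bałaban's): nothing of [I] is asserted, ported, discharged or refuted; [E] is inhabited nowhere by this file; K0ᴬ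
stmt-QuantumFields-27238 OPEN; NODE O 0∕1; COUNT 8∕28 · K 1∕4 UNMOVED; finite `𝕋⁴_{L^K}` at fixed ε — NOT continuum ∕ OS ∕ Clay; **the Yang–Mills mass gap is NOT
proved by any of this.**  No `sorry`, no `def`, no `instance`, no `notation`; standard axioms.
-/

noncomputable section

open Filter

namespace Summit.QuantumFields.YangMills.Theorems.K0AxJoinTGeomA

open Literature.MathematicalPhysics.QuantumFieldTheory.Balaban1983to89
open Literature.MathematicalPhysics.QuantumFieldTheory.Balaban1983to89.Node00
open Literature.MathematicalPhysics.QuantumFieldTheory.Balaban1983to89.T4Continuum (T4Family)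
open Literature.MathematicalPhysics.QuantumFieldTheory.Balaban1983to89.TreeLengthTorus (TPt IsTDom)
open Summit.QuantumFields.YangMills.Theorems.K0RecordFormatNames
open Summit.QuantumFields.YangMills.Theorems.PortHRecordRowG (mc_pos le_domCount_div_two eventually_window)

variable (F : T4Family)

/-! ## §1  (G0) — the centred domain embedding is injective off the wrap class, at EVERY volume (no tiling guard) -/

/-- **The cube count per direction never decreases with the volume**: `q_K ≤ q_{K+1}` for every letter `Mc` and every level (the torus side doubles its
`L`-power, the cube side is the same; ceiling division is monotone).  No `McGuard` ∕ tiling hypothesis. [cite: Balaban1987RG1, p.257 (the cubes π_j), (1.21) p.264 (bookkeeping)] -/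
theorem domCount_le_domCount_succ (Mc k K : ℕ) :
    Sect2.domCount (F.P K) Mc (k + 1) ≤ Sect2.domCount (F.P (K + 1)) Mc (k + 1) := by
  have hL : 0 < F.L := by have := F.hL.2; omega
  have hN : (F.P K).sitesPerDir 0 ≤ (F.P (K + 1)).sitesPerDir 0 := by
    rw [T4Family.sitesPerDir_eq, T4Family.sitesPerDir_eq]
    exact Nat.mul_le_mul_left _ (Nat.pow_le_pow_right hL (by omega))
  exact Nat.add_le_add_right (Nat.div_le_div_right (Nat.sub_le_sub_right hN 1)) 1

/-- **The CENTRED cube lift is injective** (every volume): two cube indices of `T_K` with the same least-absolute-value residues modulo `q_{K+1} ≥ q_K`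
are equal, because two representatives in `(−q_K∕2, q_K∕2]` differ by less than `q_K`. [cite: Balaban1987RG1, (1.21) p.264 (bookkeeping)] -/
theorem liftCubeCtr_injective (Mc k K : ℕ) : Function.Injective (liftCubeCtr F Mc k K) := by
  haveI : NeZero (Sect2.domCount (F.P K) Mc (k + 1)) := ⟨Nat.succ_ne_zero _⟩
  haveI : NeZero (Sect2.domCount (F.P (K + 1)) Mc (k + 1)) := ⟨Nat.succ_ne_zero _⟩
  intro a b h
  funext i
  have hi := congrFun h i
  dsimp only [liftCubeCtr] at hi
  rw [ZMod.intCast_eq_intCast_iff_dvd_sub] at hi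
  have hle : (Sect2.domCount (F.P K) Mc (k + 1) : ℤ) ≤ Sect2.domCount (F.P (K + 1)) Mc (k + 1) := by
    exact_mod_cast domCount_le_domCount_succ F Mc k K
  have ha := (a i).valMinAbs_mem_Ioc
  have hb := (b i).valMinAbs_mem_Ioc
  rw [Set.mem_Ioc] at ha hb
  have h0 : (b i).valMinAbs - (a i).valMinAbs = 0 :=
    Int.eq_zero_of_abs_lt_dvd hi (abs_lt.2 ⟨by linarith, by linarith⟩)
  have hab : (a i).valMinAbs = (b i).valMinAbs := by linarith
  rw [← ZMod.coe_valMinAbs (a i), ← ZMod.coe_valMinAbs (b i), hab]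

/-- ★ **(G0) AT THE NAMES, every volume: the centred domain embedding `recordDomEmbCtr` is injective OFF the wrap class `recordWrapCtr`** — off the wrap class
the embedded domain IS the centred-lifted cube family (✓`recordDomEmbCtr_val_of_not_mem`), the lift is injective (`liftCubeCtr_injective`), and a localization
domain is determined by its cube set. [cite: Balaban1987RG1, (1.21) p.264, p.257 (localization domains)] -/
theorem recordDomEmbCtr_injOn (Mc k K : ℕ) :
    Set.InjOn (recordDomEmbCtr F Mc k K) {X | X ∉ recordWrapCtr F Mc k K} := by
  intro X hX X' hX' h
  have h1 := recordDomEmbCtr_val_of_not_mem F Mc k K X hX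
  have h2 := recordDomEmbCtr_val_of_not_mem F Mc k K X' hX'
  have hval := congrArg Subtype.val h
  rw [h1, h2] at hval
  exact Subtype.ext (Finset.image_injective (liftCubeCtr_injective F Mc k K) hval)

/-- ★ **ROW (G0) of `kstep_joinT_at_record` (binder :691, verbatim)**: along the members `recordK₀ F Mc k + n`, `recordDomEmbCtr` is injective off `recordWrapCtr`.
Holds for every letter `Mc` (no guard). [cite: Balaban1987RG1, (1.21) p.264 (bookkeeping)] -/
theorem rowG0 (Mc : ℕ) :
    ∀ k n : ℕ, Set.InjOn (recordDomEmbCtr F Mc k (recordK₀ F Mc k + n)) {X | X ∉ recordWrapCtr F Mc k (recordK₀ F Mc k + n)} :=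
  fun k n => recordDomEmbCtr_injOn F Mc k (recordK₀ F Mc k + n)

/-! ## §2  The member range in closed form (catalogue guard `McGuard F Mc`): `q = 2·L^{m+n}`, `recordRNat = Mc·L^{m+n}`, `recordN = 2·Mc·L^{m+n}`, `16 ≤ q` -/

variable {F} in
/-- **Member `n` has `q = 2·L^{m+n}` cubes per direction** (`recordK₀ F Mc k = k + 1 + c` for `Mc = L^c`; exact tiling `q · L^{k+1}Mc = 2L^{m+K}`).
[cite: Balaban1987RG1, (0.1) p.251, p.257 (the cubes π_j tile the torus)] -/
theorem domCount_member_eq {Mc : ℕ} (hMc : McGuard F Mc) (k n : ℕ) :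
    Sect2.domCount (F.P (recordK₀ F Mc k + n)) Mc (k + 1) = 2 * F.L ^ (F.m + n) := by
  have h1 := domCount_mul_side_eq hMc (Nat.le_add_right (recordK₀ F Mc k) n)
  obtain ⟨c, rfl⟩ := hMc
  have hL : 1 < F.L := F.hL.2
  have hL0 : 0 < F.L := by omega
  have hlog : Nat.log F.L (F.L ^ c) = c := Nat.log_pow hL c
  rw [T4Family.sitesPerDir_eq] at h1
  simp only [recordK₀, hlog] at h1 ⊢
  have hpos : 0 < F.L ^ (k + 1) * F.L ^ c := Nat.mul_pos (Nat.pow_pos hL0) (Nat.pow_pos hL0)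
  refine Nat.eq_of_mul_eq_mul_right hpos ?_
  rw [h1, show F.m + (k + 1 + c + n) = (F.m + n) + (k + 1) + c by omega, pow_add, pow_add]
  ring

variable {F} in
/-- **◆'s safety guard never fires: every member has at least 16 cubes per direction** (indeed `q = 2·L^{m+n} ≥ 2L ≥ 26`, `L > 11` odd, `m ≥ 1`).
[cite: Balaban1987RG1, (0.1) p.251 (L > 11, m ≥ 1), (1.21) p.264 (bookkeeping)] -/
theorem sixteen_le_domCount_member {Mc : ℕ} (hMc : McGuard F Mc) (k n : ℕ) :
    16 ≤ Sect2.domCount (F.P (recordK₀ F Mc k + n)) Mc (k + 1) := by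
  have h := le_domCount_div_two hMc (Nat.le_add_right (recordK₀ F Mc k) n)
  have hL := F.hL11
  omega

variable {F} in
/-- **The comparison radius at member `n` is `Mc·L^{m+n}`.** [cite: Balaban1987RG1, (1.21) p.264 (bookkeeping)] -/
theorem recordRNat_member_eq {Mc : ℕ} (hMc : McGuard F Mc) (k n : ℕ) :
    recordRNat F Mc k (recordK₀ F Mc k + n) = Mc * F.L ^ (F.m + n) := by
  unfold recordRNat
  rw [domCount_member_eq hMc, Nat.mul_div_cancel_left _ (by norm_num : 0 < 2)]

variable {F} in
/-- The real comparison radius at member `n` is `Mc·L^{m+n}`. [cite: Balaban1987RG1, (1.21) p.264 (bookkeeping)] -/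
theorem recordR_member_eq {Mc : ℕ} (hMc : McGuard F Mc) (k n : ℕ) :
    recordR F Mc k (recordK₀ F Mc k + n) = (Mc : ℝ) * (F.L : ℝ) ^ (F.m + n) := by
  rw [recordR_eq_cast_recordRNat, recordRNat_member_eq hMc]
  push_cast
  ring

variable {F} in
/-- **The window at member `n` is `recordN = 2·Mc·L^{m+n}`** (twice the radius). [cite: Balaban1987RG1, (1.21) p.264 (bookkeeping)] -/
theorem recordN_member_eq {Mc : ℕ} (hMc : McGuard F Mc) (k n : ℕ) :
    recordN F k (recordK₀ F Mc k + n) = 2 * Mc * F.L ^ (F.m + n) := by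
  rw [recordN_eq_domCount_mul hMc (Nat.le_add_right _ _), domCount_member_eq hMc]
  ring

variable {F} in
/-- `recordN = 2 · recordRNat` along the members. [cite: Balaban1987RG1, (1.21) p.264 (bookkeeping)] -/
theorem recordN_member_eq_two_mul_recordRNat {Mc : ℕ} (hMc : McGuard F Mc) (k n : ℕ) :
    recordN F k (recordK₀ F Mc k + n) = 2 * recordRNat F Mc k (recordK₀ F Mc k + n) := by
  rw [recordN_member_eq hMc, recordRNat_member_eq hMc]
  ring

variable {F} in
/-- `13 ≤ L^{m+n}` (`L > 11` odd, `m ≥ 1`), the one numerical input of (G4). [cite: Balaban1987RG1, (0.1) p.251 (bookkeeping)] -/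
theorem thirteen_le_pow_member (n : ℕ) : (13 : ℝ) ≤ (F.L : ℝ) ^ (F.m + n) := by
  have hL : 13 ≤ F.L := by obtain ⟨r, hr⟩ := F.hL.1; have := F.hL11; omega
  have h1 : F.L ≤ F.L ^ (F.m + n) := by
    calc F.L = F.L ^ 1 := (pow_one _).symm
      _ ≤ F.L ^ (F.m + n) := Nat.pow_le_pow_right (by omega) (by have := F.hm; omega)
  exact_mod_cast hL.trans h1

/-! ## §3  (G3) — `Nin ≤ recordRNat` and eventual membership of every label in the inner window, at `Nin := recordRNat` (and at ◆'s guarded literal) -/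

/-- ★ **ROW (G3a) (binder :702, first conjunct, verbatim) at `Nin k n := recordRNat F Mc k (recordK₀ F Mc k + n)`** — `Nin ≤ recordRNat`, by reflexivity.
[cite: Balaban1987RG1, (1.21) p.264 (bookkeeping)] -/
theorem rowG3a (Mc : ℕ) : ∀ k n : ℕ, recordRNat F Mc k (recordK₀ F Mc k + n) ≤ recordRNat F Mc k (recordK₀ F Mc k + n) :=
  fun _ _ => le_rfl

variable {F} in
/-- ★ **ROW (G3b) (binder :702, second conjunct, verbatim) at `Nin := recordRNat`**: every label `z` lies strictly inside the inner window of all late members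
(`recordRNat F Mc k (recordK₀ F Mc k + n) ≥ 2ⁿ`; the tree's ✓`PortHRecordRowG.eventually_window`). [cite: Balaban1987RG1, (1.21) p.264] -/
theorem rowG3b {Mc : ℕ} (hMc : McGuard F Mc) :
    ∀ (k : ℕ) (z : Fin 4 → ℤ), ∀ᶠ n in atTop, ∀ l, 2 * |z l| < (recordRNat F Mc k (recordK₀ F Mc k + n) : ℤ) :=
  fun k z => eventually_window hMc k z

/-- ROW (G3a) at ◆'s guarded literal `Nin k n := if 16 ≤ q then recordRNat … else 0` (every letter `Mc`). [cite: Balaban1987RG1, (1.21) p.264 (bookkeeping)] -/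
theorem rowG3a_if (Mc : ℕ) : ∀ k n : ℕ,
    (if 16 ≤ Sect2.domCount (F.P (recordK₀ F Mc k + n)) Mc (k + 1) then recordRNat F Mc k (recordK₀ F Mc k + n) else 0) ≤
      recordRNat F Mc k (recordK₀ F Mc k + n) := by
  intro k n
  split_ifs
  · exact le_rfl
  · exact Nat.zero_le _

variable {F} in
/-- ROW (G3b) at ◆'s guarded literal `Nin k n := if 16 ≤ q then recordRNat … else 0` (the guard holds at every member, `sixteen_le_domCount_member`).
[cite: Balaban1987RG1, (1.21) p.264 (bookkeeping)] -/
theorem rowG3b_if {Mc : ℕ} (hMc : McGuard F Mc) : ∀ (k : ℕ) (z : Fin 4 → ℤ), ∀ᶠ n in atTop, ∀ l, 2 * |z l| <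
    ((if 16 ≤ Sect2.domCount (F.P (recordK₀ F Mc k + n)) Mc (k + 1) then recordRNat F Mc k (recordK₀ F Mc k + n) else 0 : ℕ) : ℤ) := by
  intro k z
  filter_upwards [eventually_window hMc k z] with n hn l
  rw [if_pos (sixteen_le_domCount_member hMc k n)]
  exact hn l

/-! ## §4  (G4) — `cR·recordN ≤ Rsep ∧ recordN∕4 ≤ recordRNat` at `cR := 1∕16`, `Rsep := recordR∕2 − 2·Mc` (and at ◆'s guarded literal) -/

/-- The rate `cR := 1∕16` meets the binder's guards `0 < cR ≤ 1∕4` (:673). [cite: Balaban1987RG1, (1.21) p.264 (bookkeeping)] -/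
theorem cR_record : (0 : ℝ) < 1 / 16 ∧ (1 / 16 : ℝ) ≤ 1 / 4 := by norm_num

variable {F} in
/-- **`recordN ∕ 4 ≤ recordRNat` along the members** (indeed `recordN = 2·recordRNat`; ✓`recordN_div_four_le_recordR` with `recordR = recordRNat`, the guard `2 ≤ q`
discharged by `sixteen_le_domCount_member`). [cite: Balaban1987RG1, (1.21) p.264 (bookkeeping)] -/
theorem recordN_div_four_le_recordRNat_member {Mc : ℕ} (hMc : McGuard F Mc) (k n : ℕ) :
    (recordN F k (recordK₀ F Mc k + n) : ℝ) / 4 ≤ (recordRNat F Mc k (recordK₀ F Mc k + n) : ℝ) := by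
  rw [recordN_member_eq_two_mul_recordRNat hMc]
  push_cast
  have : (0 : ℝ) ≤ recordRNat F Mc k (recordK₀ F Mc k + n) := Nat.cast_nonneg _
  linarith

variable {F} in
/-- **The seam-separation rate: `recordN ∕ 16 ≤ recordR ∕ 2 − 2·Mc` along the members** (`recordN = 2·Mc·L^{m+n}`, `recordR = Mc·L^{m+n}`, `L^{m+n} ≥ 13`, so
`recordR∕2 − 2Mc − recordN∕16 = Mc·(3L^{m+n}∕8 − 2) ≥ 0`). [cite: Balaban1987RG1, (1.21) p.264 (bookkeeping)] -/
theorem recordN_div_sixteen_le_Rsep_member {Mc : ℕ} (hMc : McGuard F Mc) (k n : ℕ) :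
    (1 / 16 : ℝ) * (recordN F k (recordK₀ F Mc k + n) : ℝ) ≤ recordR F Mc k (recordK₀ F Mc k + n) / 2 - 2 * (Mc : ℝ) := by
  rw [recordN_member_eq hMc, recordR_member_eq hMc]
  push_cast
  have hMc0 : (0 : ℝ) ≤ Mc := Nat.cast_nonneg _
  have h := mul_le_mul_of_nonneg_left (thirteen_le_pow_member (F := F) n) hMc0
  linarith

variable {F} in
/-- ★ **ROW (G4) (binder :703–704, verbatim) at `cR := 1∕16`, `Rsep k n := recordR F Mc k (recordK₀ F Mc k + n) ∕ 2 − 2·Mc`.**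
[cite: Balaban1987RG1, (1.21) p.264, (0.20) p.256 (bookkeeping)] -/
theorem rowG4 {Mc : ℕ} (hMc : McGuard F Mc) :
    ∀ k n : ℕ, (1 / 16 : ℝ) * (recordN F k (recordK₀ F Mc k + n) : ℝ) ≤ recordR F Mc k (recordK₀ F Mc k + n) / 2 - 2 * (Mc : ℝ) ∧
      (recordN F k (recordK₀ F Mc k + n) : ℝ) / 4 ≤ (recordRNat F Mc k (recordK₀ F Mc k + n) : ℝ) :=
  fun k n => ⟨recordN_div_sixteen_le_Rsep_member hMc k n, recordN_div_four_le_recordRNat_member hMc k n⟩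

variable {F} in
/-- ROW (G4) at ◆'s guarded literal `Rsep k n := if 16 ≤ q then recordR∕2 − 2·Mc else recordN` (the guard holds at every member). [cite: Balaban1987RG1, (1.21) p.264 (bookkeeping)] -/
theorem rowG4_if {Mc : ℕ} (hMc : McGuard F Mc) : ∀ k n : ℕ,
    (1 / 16 : ℝ) * (recordN F k (recordK₀ F Mc k + n) : ℝ) ≤
        (if 16 ≤ Sect2.domCount (F.P (recordK₀ F Mc k + n)) Mc (k + 1) then recordR F Mc k (recordK₀ F Mc k + n) / 2 - 2 * (Mc : ℝ)
          else (recordN F k (recordK₀ F Mc k + n) : ℝ)) ∧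
      (recordN F k (recordK₀ F Mc k + n) : ℝ) / 4 ≤ (recordRNat F Mc k (recordK₀ F Mc k + n) : ℝ) := by
  intro k n
  rw [if_pos (sixteen_le_domCount_member hMc k n)]
  exact rowG4 hMc k n

/-! ## §5  The three rows TOGETHER in the binder's letters (`Nin ∕ Rsep ∕ cR` bound to ◆'s choices) -/

variable {F} in
/-- ★★ **HAND α's ROWS OF `kstep_joinT_at_record`, TOGETHER, AT ◆ CRIT-1's RECORD CHOICES** — with `Nin k n := recordRNat F Mc k (recordK₀ F Mc k + n)`,
`Rsep k n := recordR F Mc k (recordK₀ F Mc k + n) ∕ 2 − 2·Mc`, `cR := 1∕16`: the rate guards `0 < cR ≤ 1∕4` (:673), (G0) (:691), (G3) (:702) and (G4) (:703–704), each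
conjunct the binder's text verbatim.  For every admissible letter (`McGuard F Mc`, a JOIN antecedent).  Rows (G1)(G2) (hand β, `Mg ≥ 4·Mc`), the swap row and D1 ∕ D9 ∕ D13
are NOT here. [cite: Balaban1987RG1, (1.21) p.264, (1.7) p.261, p.257 (bookkeeping)] -/
theorem geomRowsA_at_record_choices {Mc : ℕ} (hMc : McGuard F Mc) :
    let Nin : ℕ → ℕ → ℕ := fun k n => recordRNat F Mc k (recordK₀ F Mc k + n)
    let Rsep : ℕ → ℕ → ℝ := fun k n => recordR F Mc k (recordK₀ F Mc k + n) / 2 - 2 * (Mc : ℝ)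
    let cR : ℝ := 1 / 16
    (0 < cR ∧ cR ≤ 1 / 4) ∧
    (∀ k n : ℕ, Set.InjOn (recordDomEmbCtr F Mc k (recordK₀ F Mc k + n)) {X | X ∉ recordWrapCtr F Mc k (recordK₀ F Mc k + n)}) ∧
    ((∀ k n : ℕ, Nin k n ≤ recordRNat F Mc k (recordK₀ F Mc k + n)) ∧
      (∀ (k : ℕ) (z : Fin 4 → ℤ), ∀ᶠ n in atTop, ∀ l, 2 * |z l| < (Nin k n : ℤ))) ∧
    (∀ k n : ℕ, cR * (recordN F k (recordK₀ F Mc k + n) : ℝ) ≤ Rsep k n ∧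
      (recordN F k (recordK₀ F Mc k + n) : ℝ) / 4 ≤ (recordRNat F Mc k (recordK₀ F Mc k + n) : ℝ)) :=
  ⟨cR_record, rowG0 F Mc, ⟨rowG3a F Mc, rowG3b hMc⟩, rowG4 hMc⟩

variable {F} in
/-- The same package at ◆'s GUARDED literals `Nin k n := if 16 ≤ q then recordRNat … else 0`, `Rsep k n := if 16 ≤ q then recordR∕2 − 2·Mc else recordN`
(`q` = cubes per direction of member `n`; the guard holds everywhere, `sixteen_le_domCount_member`). [cite: Balaban1987RG1, (1.21) p.264 (bookkeeping)] -/
theorem geomRowsA_at_record_choices_if {Mc : ℕ} (hMc : McGuard F Mc) :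
    let Nin : ℕ → ℕ → ℕ := fun k n =>
      if 16 ≤ Sect2.domCount (F.P (recordK₀ F Mc k + n)) Mc (k + 1) then recordRNat F Mc k (recordK₀ F Mc k + n) else 0
    let Rsep : ℕ → ℕ → ℝ := fun k n =>
      if 16 ≤ Sect2.domCount (F.P (recordK₀ F Mc k + n)) Mc (k + 1) then recordR F Mc k (recordK₀ F Mc k + n) / 2 - 2 * (Mc : ℝ)
      else (recordN F k (recordK₀ F Mc k + n) : ℝ)
    let cR : ℝ := 1 / 16
    (0 < cR ∧ cR ≤ 1 / 4) ∧
    (∀ k n : ℕ, Set.InjOn (recordDomEmbCtr F Mc k (recordK₀ F Mc k + n)) {X | X ∉ recordWrapCtr F Mc k (recordK₀ F Mc k + n)}) ∧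
    ((∀ k n : ℕ, Nin k n ≤ recordRNat F Mc k (recordK₀ F Mc k + n)) ∧
      (∀ (k : ℕ) (z : Fin 4 → ℤ), ∀ᶠ n in atTop, ∀ l, 2 * |z l| < (Nin k n : ℤ))) ∧
    (∀ k n : ℕ, cR * (recordN F k (recordK₀ F Mc k + n) : ℝ) ≤ Rsep k n ∧
      (recordN F k (recordK₀ F Mc k + n) : ℝ) / 4 ≤ (recordRNat F Mc k (recordK₀ F Mc k + n) : ℝ)) :=
  ⟨cR_record, rowG0 F Mc, ⟨rowG3a_if F Mc, rowG3b_if hMc⟩, rowG4_if hMc⟩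

/-! ## §6  ★★★ THE FIT, KERNEL-CHECKED: `kstep_joinT_at_record` with hand α's rows discharged and `(Nin, Rsep, cR)` fixed to ◆'s choices -/

section KStepDischarged

open scoped Topology
open Literature.MathematicalPhysics.QuantumFieldTheory.Balaban1983to89.FlowStep
open Literature.MathematicalPhysics.QuantumFieldTheory.Balaban1983to89.FlowStepRuns
open Summit.QuantumFields.YangMills.Theorems.K0AxTwoVolumeRate (RecordPvolTwoVolExpOnRunsAx)
open Summit.QuantumFields.YangMills.Theorems.K0AxJoinT (kstep_joinT_at_record)

/-- ★★★ **`kstep_joinT_at_record` WITH HAND α's ROWS DISCHARGED** — the tree's ✓`K0AxJoinT.kstep_joinT_at_record` (JOIN-T v2 §K, ◆ CRIT-1 g36 PASS) at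
`Nin k n := recordRNat F Mc k (recordK₀ F Mc k + n)`, `Rsep k n := recordR F Mc k (recordK₀ F Mc k + n) ∕ 2 − 2·Mc`, `cR := 1∕16`, for an admissible letter (`McGuard F Mc`,
a JOIN antecedent): the guards `0 < cR ≤ 1∕4` and the rows (G0) (:691), (G3) (:702), (G4) (:703–704) are SUPPLIED by `cR_record ∕ rowG0 ∕ rowG3a ∕ rowG3b ∕ rowG4`; every other
row is displayed VERBATIM at the choices — D1 (⁸'s `FormatPlusG` mould at `recordEmbJ` on `]0, γ₀]`-runs), the swap row to `ιC`, D9 `Response9DAtJC` + D13, (G1)(G2) LARGE-OR-FAR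
(hand β; `Mg` free here, β needs `Mg ≥ 4·Mc`), leaves ⟹ [E] `RecordPvolTwoVolExpOnRunsAx F a₀ ε₂₉ γ₀ (48E₀C₉²K₀′K₁ + 32E₀C₉²e^{δ₁Mg c₁}K₀′K₁) (δ₁ ∕ 16)`, `δ₁ = delta1 δ₀ κ Mg`.
CONDITIONAL over the displayed rows (D1, D9's decay, D13 via P0 are OPEN content); nothing of Bałaban asserted; K0ᴬ 27238 OPEN; the Yang–Mills mass gap is NOT proved.
[cite: Balaban1987RG1, Thm 1 p.259, (0.20) p.256, (1.7) p.261, (1.18)–(1.22) pp.263–264, (4.4)–(4.5) pp.281–282, (4.14) p.284, (4.35)–(4.37) pp.290–291; Balaban1985Variational, Prop. 9 p.309] -/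
theorem kstep_joinT_at_record_geomA {E₀ κ C₉ δ₀ Mg c₁ K₀' K₁ : ℝ}
    (hE₀ : 0 ≤ E₀) (hκ : 0 < κ) (hC₉ : 0 ≤ C₉) (hδ₀ : 0 < δ₀) (hMg : 0 < Mg) (hK₀' : 0 ≤ K₀') :
    ∀ (F : T4Family) (a₀ ε₂₉ γ₀ α₀ α₁ : ℝ), 0 < α₀ → 0 < α₁ → ∀ (Mc : ℕ), McGuard F Mc →
      letI θ := thetaFill F a₀ ε₂₉; letI := θ.instVβ₁; letI := θ.instVβ₂; letI := θ.instιβ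
      ∀ ιC : (k n : ℕ) → recordW F a₀ ε₂₉ k (recordK₀ F Mc k + n) → (Fin (recordChartDimJ F (recordK₀ F Mc k + n)) → ℂ),
      (∀ (k : ℕ) (g : ℕ → ℝ), FlowStep.RGEqH k (betaOfRecord₁₃Ax F 2 (thetaFill F a₀ ε₂₉)) g → Step.InInterval γ₀ k g →
        B12FormatPlus.FormatPlusG (fun n => recordDomSys F Mc k (recordK₀ F Mc k + n)) (fun n => recordBondCount F (recordK₀ F Mc k + n))
          (fun n => recordAct F (recordK₀ F Mc k + n)) (fun n => recordUc F Mc k α₀ α₁ (recordK₀ F Mc k + n))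
          (fun n => recordCoords F Mc k (recordK₀ F Mc k + n)) (fun n => recordChartDimJ F (recordK₀ F Mc k + n))
          (fun n => recordChartJ F Mc k (recordK₀ F Mc k + n)) (fun n => recordΦfAx F a₀ ε₂₉ k (FlowStep.prefixOf g k) (recordK₀ F Mc k + n))
          (fun n => recordEmbJ F θ k (recordK₀ F Mc k + n)) (fun n => recordWrapCtr F Mc k (recordK₀ F Mc k + n))
          (fun n => recordDomEmbCtr F Mc k (recordK₀ F Mc k + n)) (fun n _ => recordCoordProjCtr F (recordK₀ F Mc k + n)) E₀ κ) →
      (∀ (k n : ℕ), ∀ᶠ B in 𝓝 (0 : recordW F a₀ ε₂₉ k (recordK₀ F Mc k + n)), ∀ X : (recordDomSys F Mc k (recordK₀ F Mc k + n)).Dom,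
          ∃ g : recordGaugeGrp F (recordK₀ F Mc k + n), ∀ i ∈ recordCoords F Mc k (recordK₀ F Mc k + n) X,
            recordChartJ F Mc k (recordK₀ F Mc k + n) X (ιC k n B) i =
              recordAct F (recordK₀ F Mc k + n) g (recordChartJ F Mc k (recordK₀ F Mc k + n) X (recordEmbJ F θ k (recordK₀ F Mc k + n) B)) i) →
      (∀ k : ℕ, (∀ a : θ.ιβ, Response9DAtJC F θ a Mc k (recordK₀ F Mc k) (min (1 / 4 : ℝ) (min α₁ (α₀ / 36))) C₉ δ₀) ∧
          (∀ n : ℕ, ContDiffAt ℝ 2 (ιC k n) 0 ∧ ιC k n 0 = 0) ∧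
          ∀ (n : ℕ) (a : θ.ιβ) (l : RespLabel F k (recordK₀ F Mc k + n)),
            recordGkJC F θ k (recordK₀ F Mc k + n) a l = fun i => fderiv ℝ (ιC k n) 0 (Pi.single l.1 (Pi.single l.2 (θ.bV a))) i) →
      (∀ (k n : ℕ) (X : (recordDomSys F Mc k (recordK₀ F Mc k + n)).Dom), X ∈ recordWrapCtr F Mc k (recordK₀ F Mc k + n) →
          ∀ (μ : Fin 4) (z : Fin 4 → ℤ), (∀ l, 2 * |z l| < (recordRNat F Mc k (recordK₀ F Mc k + n) : ℤ)) →
            recordR F Mc k (recordK₀ F Mc k + n) / 2 - 2 * (Mc : ℝ) ≤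
              (recordSiteGeom F Mc k (recordK₀ F Mc k + n)).distD (recordE F k (recordK₀ F Mc k + n) μ z) X +
                Mg * ((recordDomSys F Mc k (recordK₀ F Mc k + n)).dj X + c₁)) →
      (∀ (k n : ℕ) (X' : (recordDomSys F Mc k (recordK₀ F Mc k + (n + 1))).Dom),
          (∀ X, X ∉ recordWrapCtr F Mc k (recordK₀ F Mc k + n) → recordDomEmbCtr F Mc k (recordK₀ F Mc k + n) X ≠ X') →
          ∀ (μ : Fin 4) (z : Fin 4 → ℤ), (∀ l, 2 * |z l| < (recordRNat F Mc k (recordK₀ F Mc k + n) : ℤ)) →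
            recordR F Mc k (recordK₀ F Mc k + n) / 2 - 2 * (Mc : ℝ) ≤
              (recordSiteGeom F Mc k (recordK₀ F Mc k + (n + 1))).distD (recordE F k (recordK₀ F Mc k + (n + 1)) μ z) X' +
                Mg * ((recordDomSys F Mc k (recordK₀ F Mc k + (n + 1))).dj X' + c₁)) →
      (∀ k n : ℕ, B12Decay510.CubeSumLeaf (recordSiteGeom F Mc k (recordK₀ F Mc k + n)) (δ₀ / 4) K₁ ∧
          B12Decay510.TreeLeaf (recordCc F Mc k (recordK₀ F Mc k + n)) (κ / 4) K₀') →
      RecordPvolTwoVolExpOnRunsAx F a₀ ε₂₉ γ₀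
        (48 * E₀ * C₉ ^ 2 * K₀' * K₁ + 32 * E₀ * C₉ ^ 2 * Real.exp (B12Decay510.delta1 δ₀ κ Mg * Mg * c₁) * K₀' * K₁)
        (B12Decay510.delta1 δ₀ κ Mg * (1 / 16)) := by
  intro F a₀ ε₂₉ γ₀ α₀ α₁ hα₀ hα₁ Mc hMc ιC h8 hsw h9 hsepW hsepF hleaf
  exact kstep_joinT_at_record hE₀ hκ hC₉ hδ₀ hMg hK₀' F a₀ ε₂₉ γ₀ α₀ α₁ hα₀ hα₁ Mc
    (fun k n => recordRNat F Mc k (recordK₀ F Mc k + n)) (fun k n => recordR F Mc k (recordK₀ F Mc k + n) / 2 - 2 * (Mc : ℝ)) (1 / 16)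
    cR_record.1 cR_record.2 ιC h8 hsw h9 (rowG0 F Mc) hsepW hsepF (rowG3a F Mc) (rowG3b hMc) (rowG4 hMc) hleaf

end KStepDischarged

end Summit.QuantumFields.YangMills.Theorems.K0AxJoinTGeomA

end
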